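import Literature.Topology.FourManifolds.CompactlySupportedDiffeo
import Literature.Topology.FourManifolds.InverseFunctionTheorem
import Mathlib.Analysis.SpecialFunctions.SmoothTransition
import HarnessLib

/-!
# Compactly supported perturbations of the identity are compactly diffeotopic to the identity

Topic `Literature/Topology/FourManifolds` (fact seat
`provefact-Literature.Topology.FourManifolds.IsHandlebody.exists_isBoundaryGluing_sphere`, step F2b of
the Lickorish–Wallace DAG; first layer of the *isotopy-tracked* disc theorem needed by the
handle-extension step of the classification of handlebodies: the diffeomorphisms of a level
surface produced by the disc theorem must be extended over the handlebody, which requires them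
to be diffeotopic to the identity).  Everything here is **proved**; no named facts.

`CompactlySupportedDiffeo.lean` turns `C^∞` maps `Φ = id + p` of a finite-dimensional space `E`
with `‖DΦ - id‖ ≤ 1/2` into diffeomorphisms (`Diffeomorph.ofNormFDerivSubIdLe`; Hirsch,
*Differential Topology* (1976), Ch. 2 §1, Lemma 1.3 / Thm. 1.6) and builds all compactly
supported straightenings from the cut-off lemma
`Literature.Topology.FourManifolds.exists_diffeomorph_eq_add_of_norm_fderiv_le`.  The same
maps come with the **straight-line diffeotopy** `Φ_t = id + λ(t) p` (`λ` Mathlib's smooth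
transition), all of whose stages satisfy the same bound; this file records it:

* `Literature.Topology.FourManifolds.perturbationIsotopy` — for `p : E → E` smooth with
  `‖Dp‖ ≤ 1/2` everywhere and `p = 0` off `B̄(0, R)`, the ambient isotopy `t ↦ id + λ(t) p` of
  `E` (`Isotopy.lean`), and `exists_diffeotopy_of_norm_fderiv_le`: a diffeotopy of `E`
  (`Diffeotopy.lean`) with stage `1 = Diffeomorph.ofNormFDerivSubIdLe (id + p)` and all stages
  the identity off `B̄(0, R)`; hence such diffeomorphisms are diffeotopic to the identity
  (`isDiffeotopicToId_ofNormFDerivSubIdLe`).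
* `Literature.Topology.FourManifolds.exists_perturbation_of_norm_fderiv_le` — the cut-off lemma
  with the perturbation `p = χ(·/r) • g` and its derivative bound **exposed** (same proof as
  `exists_diffeomorph_eq_add_of_norm_fderiv_le`), so that the diffeotopy is available;
* `exists_diffeomorph_diffeotopy_eq_of_norm_sub_id_le`,
  `exists_diffeomorph_diffeotopy_eq_of_fderiv_eq_id` — the near-identity and the local
  straightening lemmas of `CompactlySupportedDiffeo.lean` with a compactly supported diffeotopy
  to the identity recorded (Hirsch 1976, Ch. 8 §3, proof of Thm. 3.1: these are the steps whose
  diffeomorphisms are "isotopic to the identity" in Hirsch's proof).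

## References

* M. W. Hirsch, *Differential Topology*, GTM 33 (1976), Ch. 2 §1 (Lemma 1.3, Thm. 1.6), Ch. 8
  §1 (p. 178, diffeotopies) and §3 (proof of Thm. 3.1). [HirschDT1976]
-/

open scoped Manifold ContDiff Topology
open Function Set Filter Metric

noncomputable section

namespace Literature.Topology.FourManifolds

variable {E : Type*} [NormedAddCommGroup E] [NormedSpace ℝ E] [CompleteSpace E]

/-! ### The straight-line diffeotopy of a compactly supported small perturbation -/

section Perturbation

variable {p : E → E} (hp : ContDiff ℝ ∞ p) (hb : ∀ y, ‖fderiv ℝ p y‖ ≤ 1 / 2)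

/-- The stage `Φ_t = id + λ(t) p` of the straight-line isotopy (`λ` Mathlib's
`Real.smoothTransition`). [folklore] -/
def perturbationStage (p : E → E) (t : ℝ) (y : E) : E := y + Real.smoothTransition t • p y

omit [CompleteSpace E] in
/-- The stages are jointly smooth. [folklore] -/
theorem contDiff_uncurry_perturbationStage (hp : ContDiff ℝ ∞ p) :
    ContDiff ℝ ∞ (uncurry (perturbationStage p)) :=
  contDiff_snd.add ((Real.smoothTransition.contDiff.comp contDiff_fst).smul (hp.comp contDiff_snd))

omit [CompleteSpace E] in
/-- Each stage is smooth. [folklore] -/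
theorem contDiff_perturbationStage (hp : ContDiff ℝ ∞ p) (t : ℝ) :
    ContDiff ℝ ∞ (perturbationStage p t) :=
  contDiff_id.add (contDiff_const.smul hp)

omit [CompleteSpace E] in
/-- Each stage satisfies `‖DΦ_t - id‖ ≤ 1/2` (as `0 ≤ λ ≤ 1`). [folklore] -/
theorem norm_fderiv_perturbationStage_sub_id_le (hp : ContDiff ℝ ∞ p)
    (hb : ∀ y, ‖fderiv ℝ p y‖ ≤ 1 / 2) (t : ℝ) (y : E) :
    ‖fderiv ℝ (perturbationStage p t) y - ContinuousLinearMap.id ℝ E‖ ≤ 1 / 2 := by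
  have hd : HasFDerivAt (perturbationStage p t)
      (ContinuousLinearMap.id ℝ E + Real.smoothTransition t • fderiv ℝ p y) y :=
    (hasFDerivAt_id y).add ((hp.differentiable (by simp) y).hasFDerivAt.const_smul _)
  rw [hd.fderiv, add_sub_cancel_left, norm_smul, Real.norm_eq_abs,
    abs_of_nonneg (Real.smoothTransition.nonneg t)]
  calc Real.smoothTransition t * ‖fderiv ℝ p y‖ ≤ 1 * (1 / 2) :=
      mul_le_mul (Real.smoothTransition.le_one t) (hb y) (norm_nonneg _) zero_le_one
    _ = 1 / 2 := one_mul _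

/-- The stage as a diffeomorphism of `E`. [cite: Hirsch1976, Ch. 2 Lemma 1.3 and Thm. 1.6] -/
def perturbationStageDiffeo (t : ℝ) : E ≃ₘ⟮𝓘(ℝ, E), 𝓘(ℝ, E)⟯ E :=
  Diffeomorph.ofNormFDerivSubIdLe (perturbationStage p t) (contDiff_perturbationStage hp t)
    (by simp) (norm_fderiv_perturbationStage_sub_id_le hp hb t)

/-- **The straight-line ambient isotopy** `t ↦ id + λ(t) p` of `E` (`Isotopy.lean`).
[cite: HirschDT1976, Ch. 8 §1, p. 178] -/
def perturbationIsotopy : AmbientIsotopy 𝓘(ℝ, E) E where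
  toFun := perturbationStage p
  contMDiff := by
    rw [← modelWithCornersSelf_prod, chartedSpaceSelf_prod]
    exact (contDiff_uncurry_perturbationStage hp).contMDiff
  bijective t := (perturbationStageDiffeo hp hb t).bijective
  isLocalDiffeomorph t := (perturbationStageDiffeo hp hb t).isLocalDiffeomorph
  map_zero := by
    funext y
    simp [perturbationStage, Real.smoothTransition.zero_of_nonpos le_rfl]

/-- The stages of the straight-line isotopy (definitional). [folklore] -/
@[simp]
theorem perturbationIsotopy_toFun : (perturbationIsotopy hp hb).toFun = perturbationStage p := rfl

omit [CompleteSpace E] in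
/-- `id + p` satisfies `‖D(id + p) - id‖ ≤ 1/2`. [folklore] -/
theorem norm_fderiv_id_add_sub_id_le (hp : ContDiff ℝ ∞ p) (hb : ∀ y, ‖fderiv ℝ p y‖ ≤ 1 / 2)
    (y : E) : ‖fderiv ℝ (fun y => y + p y) y - ContinuousLinearMap.id ℝ E‖ ≤ 1 / 2 := by
  have hd : HasFDerivAt (fun y => y + p y) (ContinuousLinearMap.id ℝ E + fderiv ℝ p y) y :=
    (hasFDerivAt_id y).add (hp.differentiable (by simp) y).hasFDerivAt
  rw [hd.fderiv, add_sub_cancel_left]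
  exact hb y

/-- **The diffeomorphism `id + p`** of a small perturbation `p` (`‖Dp‖ ≤ 1/2`) of the identity
(`Diffeomorph.ofNormFDerivSubIdLe`). [cite: Hirsch1976, Ch. 2 Lemma 1.3 and Thm. 1.6] -/
def addDiffeo : E ≃ₘ⟮𝓘(ℝ, E), 𝓘(ℝ, E)⟯ E :=
  Diffeomorph.ofNormFDerivSubIdLe (fun y => y + p y) (contDiff_id.add hp) (by simp)
    (norm_fderiv_id_add_sub_id_le hp hb)

/-- `addDiffeo hp hb y = y + p y` (definitional). [folklore] -/
@[simp]
theorem addDiffeo_apply (y : E) : addDiffeo hp hb y = y + p y := rfl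

/-- **A compactly supported small perturbation of the identity is compactly diffeotopic to the
identity**: for `p` smooth with `‖Dp‖ ≤ 1/2` and `p = 0` off `B̄(0, R)` there is a diffeotopy of
`E` with stage `1` the diffeomorphism `id + p` (`addDiffeo`) and all stages the identity off
`B̄(0, R)`. [cite: HirschDT1976, Ch. 8 §1, p. 178] -/
theorem exists_diffeotopy_of_norm_fderiv_le {R : ℝ} (hR : ∀ y, R ≤ ‖y‖ → p y = 0) :
    ∃ D : Diffeotopy 𝓘(ℝ, E) E, D.stage 1 = addDiffeo hp hb ∧ ∀ t y, R ≤ ‖y‖ → D.toFun t y = y := by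
  refine ⟨(perturbationIsotopy hp hb).toDiffeotopy, Diffeomorph.ext fun y => ?_, fun t y hy => ?_⟩
  · show perturbationStage p 1 y = y + p y
    simp [perturbationStage, Real.smoothTransition.one_of_one_le le_rfl]
  · show perturbationStage p t y = y
    simp [perturbationStage, hR y hy]

/-- In particular the diffeomorphism `id + p` is diffeotopic to the identity of `E`.
[cite: HirschDT1976, Ch. 8 §1, p. 178] -/
theorem isDiffeotopicToId_addDiffeo {R : ℝ} (hR : ∀ y, R ≤ ‖y‖ → p y = 0) :
    Diffeomorph.IsDiffeotopicToId (addDiffeo hp hb) := by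
  obtain ⟨D, hD, -⟩ := exists_diffeotopy_of_norm_fderiv_le hp hb hR
  exact ⟨D, hD⟩

end Perturbation

/-! ### The cut-off lemma with the perturbation exposed -/

/-- **Cut-off lemma, with the perturbation exposed.**  There is `ε₀ > 0` (depending only on
`E`) such that: for every `r > 0` and every `g : E → E`, `C^∞` on an open `V ⊇ B̄(0, 2r)` with
`g 0 = 0` and `‖Dg‖ ≤ ε₀` on `B̄(0, 2r)`, the cut-off perturbation `p = χ(·/r) • g` is smooth on
`E`, satisfies `‖Dp‖ ≤ 1/2` everywhere, `p = g` on `B̄(0, r)` and `p = 0` off `B(0, 2r)`.  Same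
proof as `Literature.Topology.FourManifolds.exists_diffeomorph_eq_add_of_norm_fderiv_le`, which
records only the resulting diffeomorphism `id + p`. [cite: HirschDT1976, Ch. 8 §3, proof of Thm. 3.1] -/
theorem exists_perturbation_of_norm_fderiv_le (E : Type*) [NormedAddCommGroup E]
    [NormedSpace ℝ E] [FiniteDimensional ℝ E] [CompleteSpace E] :
    ∃ ε₀ > (0 : ℝ), ∀ r > (0 : ℝ), ∀ (g : E → E) (V : Set E), IsOpen V →
      closedBall (0 : E) (2 * r) ⊆ V → ContDiffOn ℝ ∞ g V → g 0 = 0 →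
      (∀ z ∈ closedBall (0 : E) (2 * r), ‖fderiv ℝ g z‖ ≤ ε₀) →
      ∃ p : E → E, ContDiff ℝ ∞ p ∧ (∀ y, ‖fderiv ℝ p y‖ ≤ 1 / 2) ∧
        (∀ y ∈ closedBall (0 : E) r, p y = g y) ∧ (∀ y, 2 * r ≤ ‖y‖ → p y = 0) := by
  -- a fixed bump function and a bound for its derivative
  let χ : ContDiffBump (0 : E) := ⟨1, 2, one_pos, by norm_num⟩
  have hχc : ContDiff ℝ ∞ χ := χ.contDiff
  obtain ⟨C₀, hC₀⟩ := (χ.hasCompactSupport.fderiv ℝ).exists_bound_of_continuous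
    (hχc.continuous_fderiv (by simp))
  set C : ℝ := max C₀ 0 with hC
  have hC0 : 0 ≤ C := le_max_right _ _
  have hCb : ∀ z, ‖fderiv ℝ χ z‖ ≤ C := fun z ↦ (hC₀ z).trans (le_max_left _ _)
  refine ⟨1 / (2 * (1 + 2 * C)), by positivity, ?_⟩
  intro r hr g V hVo hVB hg hg0 hgb
  set ε₀ : ℝ := 1 / (2 * (1 + 2 * C)) with hε₀
  have hε₀0 : 0 < ε₀ := by positivity
  -- the rescaled bump `χr y = χ (y / r)`
  set χr : E → ℝ := fun y ↦ χ (r⁻¹ • y) with hχr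
  have hχr_smooth : ContDiff ℝ ∞ χr := hχc.comp (contDiff_const_smul r⁻¹)
  have hχr_one : ∀ y ∈ closedBall (0 : E) r, χr y = 1 := by
    intro y hy
    apply χ.one_of_mem_closedBall
    simp only [mem_closedBall, dist_zero_right, norm_smul, norm_inv, Real.norm_eq_abs,
      abs_of_pos hr] at hy ⊢
    rw [inv_mul_le_iff₀ hr]
    show ‖y‖ ≤ r * 1
    simpa using hy
  have hχr_zero : ∀ y, 2 * r ≤ ‖y‖ → χr y = 0 := by
    intro y hy
    apply χ.zero_of_le_dist
    simp only [dist_zero_right, norm_smul, norm_inv, Real.norm_eq_abs, abs_of_pos hr]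
    rw [le_inv_mul_iff₀ hr]
    show r * 2 ≤ ‖y‖
    linarith
  have hχr_le : ∀ y, |χr y| ≤ 1 := fun y ↦ by
    rw [abs_of_nonneg (χ.nonneg' _)]
    exact χ.le_one
  have hχr_fderiv : ∀ y, ‖fderiv ℝ χr y‖ ≤ C / r := by
    intro y
    have h1 : HasFDerivAt χr ((fderiv ℝ χ (r⁻¹ • y)).comp (r⁻¹ • ContinuousLinearMap.id ℝ E)) y := by
      have hd : HasFDerivAt χ (fderiv ℝ χ (r⁻¹ • y)) (r⁻¹ • y) :=
        (hχc.differentiable (by simp) _).hasFDerivAt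
      have hl : HasFDerivAt (fun y : E ↦ r⁻¹ • y) (r⁻¹ • ContinuousLinearMap.id ℝ E) y :=
        (hasFDerivAt_id y).const_smul r⁻¹
      exact hd.comp y hl
    rw [h1.fderiv]
    calc ‖(fderiv ℝ χ (r⁻¹ • y)).comp (r⁻¹ • ContinuousLinearMap.id ℝ E)‖
        ≤ ‖fderiv ℝ χ (r⁻¹ • y)‖ * ‖r⁻¹ • ContinuousLinearMap.id ℝ E‖ :=
          ContinuousLinearMap.opNorm_comp_le _ _
      _ ≤ C * r⁻¹ := by
          gcongr
          · exact hCb _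
          · rw [norm_smul, norm_inv, Real.norm_eq_abs, abs_of_pos hr]
            simpa using mul_le_of_le_one_right (inv_nonneg.mpr hr.le)
              (ContinuousLinearMap.norm_id_le (𝕜 := ℝ) (E := E))
      _ = C / r := by rw [div_eq_mul_inv]
  have hχr_ev : ∀ y, 2 * r < ‖y‖ → χr =ᶠ[𝓝 y] fun _ ↦ 0 := by
    intro y hy
    have ho : IsOpen {z : E | 2 * r < ‖z‖} := isOpen_lt continuous_const continuous_norm
    filter_upwards [ho.mem_nhds hy] with z hz
    exact hχr_zero z (le_of_lt hz)
  -- the perturbation `p = χr • g`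
  set φ : E → E := fun y ↦ χr y • g y with hφ
  have hgd : ∀ z ∈ V, DifferentiableAt ℝ g z := fun z hz ↦
    (hg.contDiffAt (hVo.mem_nhds hz)).differentiableAt (by simp)
  have hg_bound : ∀ y ∈ closedBall (0 : E) (2 * r), ‖g y‖ ≤ ε₀ * ‖y‖ := by
    intro y hy
    have := (convex_closedBall (0 : E) (2 * r)).norm_image_sub_le_of_norm_fderiv_le
      (fun z hz ↦ hgd z (hVB hz)) hgb (mem_closedBall_self (by positivity)) hy
    simpa [hg0] using this
  have hφ_smooth : ContDiff ℝ ∞ φ := by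
    rw [contDiff_iff_contDiffAt]
    intro y
    by_cases hy : y ∈ V
    · exact hχr_smooth.contDiffAt.smul (hg.contDiffAt (hVo.mem_nhds hy))
    · have hy2 : 2 * r < ‖y‖ := by
        by_contra h'
        exact hy (hVB (by simpa using not_lt.mp h'))
      refine (contDiffAt_const (c := (0 : E))).congr_of_eventuallyEq ?_
      filter_upwards [hχr_ev y hy2] with z hz
      simp [hφ, hz]
  have hφ_zero : ∀ y, 2 * r ≤ ‖y‖ → φ y = 0 := fun y hy ↦ by simp [hφ, hχr_zero y hy]
  have hφ_fderiv : ∀ y, ‖fderiv ℝ φ y‖ ≤ 1 / 2 := by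
    intro y
    rcases le_or_gt ‖y‖ (2 * r) with hy | hy
    · have hyB : y ∈ closedBall (0 : E) (2 * r) := by simpa using hy
      have hyV : y ∈ V := hVB hyB
      have hd : HasFDerivAt φ (χr y • fderiv ℝ g y + (fderiv ℝ χr y).smulRight (g y)) y :=
        (hχr_smooth.differentiable (by simp) y).hasFDerivAt.smul (hgd y hyV).hasFDerivAt
      rw [hd.fderiv]
      calc ‖χr y • fderiv ℝ g y + (fderiv ℝ χr y).smulRight (g y)‖
          ≤ ‖χr y • fderiv ℝ g y‖ + ‖(fderiv ℝ χr y).smulRight (g y)‖ := norm_add_le _ _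
        _ = |χr y| * ‖fderiv ℝ g y‖ + ‖fderiv ℝ χr y‖ * ‖g y‖ := by
            rw [norm_smul, Real.norm_eq_abs, ContinuousLinearMap.norm_smulRight_apply]
        _ ≤ 1 * ε₀ + C / r * (ε₀ * ‖y‖) := by
            gcongr
            · exact hχr_le y
            · exact hgb y hyB
            · exact hχr_fderiv y
            · exact hg_bound y hyB
        _ ≤ 1 * ε₀ + C / r * (ε₀ * (2 * r)) := by gcongr
        _ = ε₀ * (1 + 2 * C) := by field_simp
        _ = 1 / 2 := by rw [hε₀]; field_simp
    · have : fderiv ℝ φ y = 0 := by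
        have hev : φ =ᶠ[𝓝 y] fun _ ↦ 0 := by
          filter_upwards [hχr_ev y hy] with z hz
          simp [hφ, hz]
        rw [hev.fderiv_eq, fderiv_const_apply]
      rw [this, norm_zero]
      norm_num
  refine ⟨φ, hφ_smooth, hφ_fderiv, fun y hy => ?_, hφ_zero⟩
  simp [hφ, hχr_one y hy]

/-! ### Near-identity linear maps and local straightening, with diffeotopies -/

/-- **Near-identity linear maps are compactly straightenable by diffeomorphisms diffeotopic to
the identity.**  There is `δ₀ > 0` such that every continuous linear `X : E → E` with
`‖X - id‖ ≤ δ₀` agrees on the closed unit ball with a diffeomorphism `G` of `E` which is the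
identity off `B(0, 2)` and is the time-`1` stage of a diffeotopy of `E` supported in `B̄(0, 2)`
(so in particular `G` is diffeotopic to the identity). Hirsch (1976), Ch. 8 §3, proof of
Thm. 3.1. [cite: HirschDT1976, Ch. 8 §3, proof of Thm. 3.1] -/
theorem exists_diffeomorph_diffeotopy_eq_of_norm_sub_id_le (E : Type*) [NormedAddCommGroup E]
    [NormedSpace ℝ E] [FiniteDimensional ℝ E] [CompleteSpace E] :
    ∃ δ₀ > (0 : ℝ), ∀ X : E →L[ℝ] E, ‖X - ContinuousLinearMap.id ℝ E‖ ≤ δ₀ →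
      ∃ (G : E ≃ₘ⟮𝓘(ℝ, E), 𝓘(ℝ, E)⟯ E) (D : Diffeotopy 𝓘(ℝ, E) E),
        (∀ y ∈ closedBall (0 : E) 1, G y = X y) ∧ (∀ y, 2 ≤ ‖y‖ → G y = y) ∧
        D.stage 1 = G ∧ ∀ t y, 2 ≤ ‖y‖ → D.toFun t y = y := by
  obtain ⟨ε₀, hε₀, H⟩ := exists_perturbation_of_norm_fderiv_le E
  refine ⟨ε₀, hε₀, fun X hX ↦ ?_⟩
  set g : E → E := fun y ↦ X y - y with hg
  have hgd : ∀ z, HasFDerivAt g (X - ContinuousLinearMap.id ℝ E) z := fun z ↦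
    X.hasFDerivAt.sub (hasFDerivAt_id z)
  obtain ⟨p, hp, hb, hp1, hp2⟩ := H 1 one_pos g univ isOpen_univ (subset_univ _)
    (X.contDiff.sub contDiff_id).contDiffOn (by simp [hg])
    (fun z _ ↦ by rw [(hgd z).fderiv]; exact hX)
  have hp2' : ∀ y, 2 ≤ ‖y‖ → p y = 0 := fun y hy => hp2 y (by simpa using hy)
  obtain ⟨D, hD1, hD2⟩ := exists_diffeotopy_of_norm_fderiv_le hp hb hp2'
  refine ⟨addDiffeo hp hb, D, fun y hy ↦ ?_, fun y hy ↦ ?_, hD1, hD2⟩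
  · rw [addDiffeo_apply, hp1 y (by simpa using hy), hg]
    simp
  · rw [addDiffeo_apply, hp2' y hy, add_zero]

/-- **Local straightening of a map tangent to the identity, by a diffeomorphism diffeotopic to
the identity.**  If `F` is `C^∞` on an open `V ∋ 0` with `F 0 = 0` and `DF(0) = id`, then for
some `r > 0` with `B̄(0, 2r) ⊆ V` there are a diffeomorphism `G` of `E` with `G = F` on `B̄(0, r)`
and `G = id` off `B(0, 2r)`, and a diffeotopy of `E` supported in `B̄(0, 2r)` with stage
`1 = G`. Hirsch (1976), Ch. 8 §3, proof of Thm. 3.1 (first step). [cite: HirschDT1976, Ch. 8 §3, proof of Thm. 3.1] -/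
theorem exists_diffeomorph_diffeotopy_eq_of_fderiv_eq_id [FiniteDimensional ℝ E] {F : E → E}
    {V : Set E} (hV : IsOpen V)
    (h0 : (0 : E) ∈ V) (hF : ContDiffOn ℝ ∞ F V) (hF0 : F 0 = 0)
    (hDF : fderiv ℝ F 0 = ContinuousLinearMap.id ℝ E) :
    ∃ r > (0 : ℝ), closedBall (0 : E) (2 * r) ⊆ V ∧
      ∃ (G : E ≃ₘ⟮𝓘(ℝ, E), 𝓘(ℝ, E)⟯ E) (D : Diffeotopy 𝓘(ℝ, E) E),
        (∀ y ∈ closedBall (0 : E) r, G y = F y) ∧ (∀ y, 2 * r ≤ ‖y‖ → G y = y) ∧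
        D.stage 1 = G ∧ ∀ t y, 2 * r ≤ ‖y‖ → D.toFun t y = y := by
  obtain ⟨ε₀, hε₀, H⟩ := exists_perturbation_of_norm_fderiv_le E
  have hcont : ContinuousAt (fderiv ℝ F) 0 :=
    ((hF.continuousOn_fderiv_of_isOpen hV (by simp)).continuousAt (hV.mem_nhds h0))
  obtain ⟨ρ, hρ, hρb⟩ : ∃ ρ > (0 : ℝ), ball (0 : E) ρ ⊆ V ∧
      ∀ z ∈ ball (0 : E) ρ, ‖fderiv ℝ F z - ContinuousLinearMap.id ℝ E‖ ≤ ε₀ := by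
    have h1 : ∀ᶠ z in 𝓝 (0 : E), ‖fderiv ℝ F z - ContinuousLinearMap.id ℝ E‖ ≤ ε₀ := by
      have := (Metric.tendsto_nhds.mp hcont) ε₀ hε₀
      filter_upwards [this] with z hz
      rw [hDF, dist_eq_norm] at hz
      exact hz.le
    obtain ⟨ρ, hρ, hρb⟩ := Metric.eventually_nhds_iff_ball.mp (h1.and (hV.mem_nhds h0))
    exact ⟨ρ, hρ, fun z hz ↦ (hρb z hz).2, fun z hz ↦ (hρb z hz).1⟩
  obtain ⟨hρV, hρb⟩ := hρb
  set r : ℝ := ρ / 3 with hr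
  have hr0 : 0 < r := by positivity
  have hBV : closedBall (0 : E) (2 * r) ⊆ ball (0 : E) ρ :=
    closedBall_subset_ball (by rw [hr]; linarith)
  set g : E → E := fun y ↦ F y - y with hg
  have hgV : ContDiffOn ℝ ∞ g V := hF.sub contDiffOn_id
  have hgd : ∀ z ∈ V, fderiv ℝ g z = fderiv ℝ F z - ContinuousLinearMap.id ℝ E := by
    intro z hz
    have hFz : DifferentiableAt ℝ F z := (hF.contDiffAt (hV.mem_nhds hz)).differentiableAt (by simp)
    exact (hFz.hasFDerivAt.sub (hasFDerivAt_id z)).fderiv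
  obtain ⟨p, hp, hb, hp1, hp2⟩ := H r hr0 g V hV (hBV.trans hρV) hgV (by simp [hg, hF0])
    (fun z hz ↦ by rw [hgd z (hρV (hBV hz))]; exact hρb z (hBV hz))
  obtain ⟨D, hD1, hD2⟩ := exists_diffeotopy_of_norm_fderiv_le hp hb hp2
  refine ⟨r, hr0, hBV.trans hρV, addDiffeo hp hb, D, fun y hy ↦ ?_, fun y hy ↦ ?_, hD1, hD2⟩
  · rw [addDiffeo_apply, hp1 y hy, hg]
    simp
  · rw [addDiffeo_apply, hp2 y hy, add_zero]

end Literature.Topology.FourManifolds
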